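import Summits.Langlands.Langlands.Theses.PicardMuOrdinary
import Literature.NumberTheory.EllipticCurves.PadicSeriesEvaluation

/-!
# `stub_accumulate` of line `free-seed-smooth-rt` needs its regularity hypothesis `eT`

Negative lemma for the crux `PicardMuOrdinary.MuOrdinaryFamilyRT` (stmt-Langlands-13757), standing
disprover refuter-cdisprove-stmt-Langlands-13757-g2-0, cycle 2 (2026-08-16).

`S.stub_accumulate` (Stub 4 of the REGISTERED skeleton `Cruxes/MuOrdinaryFamilyRT/Lines/
free-seed-smooth-rt.lean`, "provable now") asserts: for `T ≅ 𝒪⟦X,Y,Z⟧` (hypothesis `eT`) finite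
and injective over `Λ : 𝒪⟦T₁,T₂,T₃⟧ → T`, a `ℚ̄₃`-point `x` of `T` and weights `W` accumulating
uniformly at `x ∘ Λ`, some weight of `W` lifts to a point `y` of `T` uniformly close to `x`.
`stub_accumulate_false_without_eT` below is that statement with the single hypothesis
`(eT : MvPowerSeries (Fin 3) 𝒪 ≃ₐ[𝒪] T)` DELETED, everything else verbatim — and it is FALSE:
`𝒪 = ℤ₃`, `T = ℤ₃⟦X,Y,Z⟧ × ℤ₃`, `Λ = (id, constant term)`, `x` the point of the torsion factor,
`W = {evaluation at (3^(M+1), 0, 0)}`.  So `eT` is load-bearing, at least through "every minimal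
prime of `T` lies over `(0)` of `Λ`" (no `Λ`-torsion component carrying `x`): the same phenomenon
as `AccumulationDominance.lean` (weight-blind line, Stub C).  Informal complement (not proved
here): for `T` merely finite and TORSION-FREE over the regular `Λ`, accumulation should already
hold (finite dominant maps onto a normal base are universally open, EGA IV 14.4.4), i.e. the full
regularity of `T` is probably used only through torsion-freeness / dominance.
-/

namespace Summit.Langlands.Langlands.Theorems.MuOrdinaryFamilyRT.Negative

set_option linter.dupNamespace false

open MvPowerSeries.WithPiTopology
open Literature.NumberTheory.EllipticCurves

noncomputable section

/-- Ultrametric tail estimate for the evaluation of an integral power series at a point of the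
open unit polydisc: `‖f(b) − f(0)‖ ≤ max ‖b_i‖`. [folklore] -/
theorem norm_aeval_sub_constantCoeff_le {b : Fin 3 → ℤ_[3]} {r : ℝ} (hr0 : 0 ≤ r) (hr1 : r < 1)
    (hb : ∀ i, ‖b i‖ ≤ r) (f : MvPowerSeries (Fin 3) ℤ_[3]) :
    ‖MvPowerSeries.aeval (padicInt_mvHasEval (fun i => (hb i).trans_lt hr1)) f -
        MvPowerSeries.constantCoeff f‖ ≤ r := by
  classical
  set ha : MvPowerSeries.HasEval b := padicInt_mvHasEval (fun i => (hb i).trans_lt hr1)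
  have hs := MvPowerSeries.hasSum_aeval ha f
  have hs' := hasSum_ite_sub_hasSum hs 0
  have h0 : (MvPowerSeries.coeff (0 : Fin 3 →₀ ℕ) f) • ((0 : Fin 3 →₀ ℕ).prod fun s e => b s ^ e)
      = MvPowerSeries.constantCoeff f := by
    rw [Finsupp.prod_zero_index, smul_eq_mul, mul_one, MvPowerSeries.coeff_zero_eq_constantCoeff_apply]
  rw [h0] at hs'
  rw [← hs'.tsum_eq]
  refine IsUltrametricDist.norm_tsum_le_of_forall_le_of_nonneg hr0 fun d => ?_
  split_ifs with hd
  · simpa using hr0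
  · rw [smul_eq_mul, norm_mul]
    have hc : ‖MvPowerSeries.coeff d f‖ ≤ 1 := PadicInt.norm_le_one _
    have hprod : ‖d.prod fun s e => b s ^ e‖ ≤ r := by
      rw [Finsupp.prod, norm_prod]
      obtain ⟨s₀, hs₀⟩ : d.support.Nonempty := by
        rw [Finsupp.support_nonempty_iff]; exact hd
      rw [← Finset.mul_prod_erase _ _ hs₀]
      have h1 : ‖b s₀ ^ d s₀‖ ≤ r := by
        rw [norm_pow]
        have hds : 1 ≤ d s₀ := Nat.one_le_iff_ne_zero.mpr (Finsupp.mem_support_iff.mp hs₀)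
        calc ‖b s₀‖ ^ d s₀ ≤ ‖b s₀‖ ^ 1 :=
              pow_le_pow_of_le_one (norm_nonneg _) ((hb s₀).trans hr1.le) hds
          _ ≤ r := by rw [pow_one]; exact hb s₀
      have h2 : ∏ x ∈ d.support.erase s₀, ‖b x ^ d x‖ ≤ 1 := by
        refine Finset.prod_le_one (fun _ _ => norm_nonneg _) fun x _ => ?_
        rw [norm_pow]
        exact pow_le_one₀ (norm_nonneg _) ((hb x).trans hr1.le)
      calc ‖b s₀ ^ d s₀‖ * ∏ x ∈ d.support.erase s₀, ‖b x ^ d x‖ ≤ r * 1 := by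
            apply mul_le_mul h1 h2 (Finset.prod_nonneg fun _ _ => norm_nonneg _) hr0
        _ = r := mul_one r
    calc ‖MvPowerSeries.coeff d f‖ * ‖d.prod fun s e => b s ^ e‖ ≤ 1 * r :=
          mul_le_mul hc hprod (norm_nonneg _) zero_le_one
      _ = r := one_mul r

/-- `‖algebraMap ℤ₃ ℚ̄₃ z‖ = ‖z‖`. [folklore] -/
theorem norm_algebraMap_padicAlgCl (z : ℤ_[3]) : ‖algebraMap ℤ_[3] (PadicAlgCl 3) z‖ = ‖z‖ := by
  rw [IsScalarTower.algebraMap_apply ℤ_[3] ℚ_[3] (PadicAlgCl 3)]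
  change ‖((z : ℚ_[3]) : PadicAlgCl 3)‖ = ‖z‖
  rw [PadicAlgCl.norm_extends, PadicInt.padic_norm_e_of_padicInt]

/-- `(1/3)^(M+1) < 1`. [folklore] -/
theorem inv_three_pow_succ_lt_one (M : ℕ) : ((3 : ℝ)⁻¹) ^ (M + 1) < 1 :=
  pow_lt_one₀ (by norm_num) (by norm_num) (Nat.succ_ne_zero M)

/-- The small points `(3^(M+1), 0, 0)` lie in the polydisc of radius `3^{-(M+1)}`. [folklore] -/
theorem norm_smallPoint_le (M : ℕ) (i : Fin 3) :
    ‖(fun i : Fin 3 => if i = 0 then (3 : ℤ_[3]) ^ (M + 1) else 0) i‖ ≤ ((3 : ℝ)⁻¹) ^ (M + 1) := by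
  dsimp only
  split_ifs
  · rw [norm_pow]
    have : ‖(3 : ℤ_[3])‖ = (3 : ℝ)⁻¹ := by simpa using PadicInt.norm_p (p := 3)
    rw [this]
  · simp

/-- **`stub_accumulate` without `eT` is false.**  The statement below is `S.stub_accumulate` of
`Lines/free-seed-smooth-rt.lean` verbatim, except that the hypothesis
`(eT : MvPowerSeries (Fin 3) 𝒪 ≃ₐ[𝒪] T)` has been deleted.  Witness: `𝒪 = ℤ₃`,
`T = ℤ₃⟦X,Y,Z⟧ × ℤ₃`, `Λ = (id, constant term)` (injective; finite: generators `(1,0), (0,1)`),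
`x = ι ∘ snd` (the torsion factor, over the weight "constant term"), `W = {κ_M}` with
`κ_M = ι ∘ (evaluation at (3^(M+1), 0, 0))`, uniformly within `3^{-(M+1)}` of `x ∘ Λ` by
`norm_aeval_sub_constantCoeff_le`.  A point `y` over `κ_M` has `y (0,1) ∈ {0, 1}` while
`x (0,1) = 1`; `y (0,1) = 0` is at distance `1 > 1/3`; `y (0,1) = 1` forces `y (1,0) = 0`, hence
`y (Λ X₀) = y (X₀, 0) = 0`, contradicting `y ∘ Λ = κ_M` at `X₀` (`κ_M X₀ = 3^{M+1} ≠ 0`).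
Any proof of Stub 4 must therefore USE `eT` (at least: `T` has no `Λ`-torsion component).
[folklore] -/
theorem stub_accumulate_false_without_eT :
    ¬ ∀ (𝒪 : Type) [CommRing 𝒪] [IsDomain 𝒪] [IsDiscreteValuationRing 𝒪] [Algebra ℤ_[3] 𝒪]
      [Module.Finite ℤ_[3] 𝒪] (j : 𝒪 →+* PadicAlgCl 3), Function.Injective j →
      j.comp (algebraMap ℤ_[3] 𝒪) = algebraMap ℤ_[3] (PadicAlgCl 3) →
      ∀ (T : Type) [CommRing T] [Algebra 𝒪 T]
        (Λ : MvPowerSeries (Fin 3) 𝒪 →ₐ[𝒪] T), Function.Injective Λ → Λ.toRingHom.Finite →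
      ∀ (x : T →+* PadicAlgCl 3), x.comp (algebraMap 𝒪 T) = j →
      ∀ (W : Set (MvPowerSeries (Fin 3) 𝒪 →+* PadicAlgCl 3)),
        (∀ M : ℕ, ∃ κ ∈ W, ∀ a, ‖κ a - x (Λ a)‖ ≤ ((3 : ℝ)⁻¹) ^ M) →
      ∀ M : ℕ, ∃ κ ∈ W, ∃ y : T →+* PadicAlgCl 3,
        y.comp Λ.toRingHom = κ ∧ ∀ t, ‖y t - x t‖ ≤ ((3 : ℝ)⁻¹) ^ M := by
  classical
  intro h
  -- the constant-term map as a ℤ₃-algebra hom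
  let ev0 : MvPowerSeries (Fin 3) ℤ_[3] →ₐ[ℤ_[3]] ℤ_[3] :=
    { (MvPowerSeries.constantCoeff : MvPowerSeries (Fin 3) ℤ_[3] →+* ℤ_[3]) with
      commutes' := fun r => by
        change MvPowerSeries.constantCoeff (algebraMap ℤ_[3] (MvPowerSeries (Fin 3) ℤ_[3]) r) = r
        rw [MvPowerSeries.algebraMap_apply, MvPowerSeries.constantCoeff_C, Algebra.algebraMap_self,
          RingHom.id_apply] }
  set P := MvPowerSeries (Fin 3) ℤ_[3] with hP
  set ι : ℤ_[3] →+* PadicAlgCl 3 := algebraMap ℤ_[3] (PadicAlgCl 3) with hι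
  have hιinj : Function.Injective ι := by
    intro a b hab
    have : ‖ι (a - b)‖ = 0 := by rw [map_sub, hab, sub_self, norm_zero]
    rw [norm_algebraMap_padicAlgCl, norm_eq_zero] at this
    exact sub_eq_zero.mp this
  -- T = P × ℤ₃, Λ = (id, ev0)
  let Λ : P →ₐ[ℤ_[3]] (P × ℤ_[3]) := (AlgHom.id ℤ_[3] P).prod ev0
  have hΛ : ∀ a, Λ a = (a, MvPowerSeries.constantCoeff a) := fun a => rfl
  have hΛinj : Function.Injective Λ := fun a b hab => by
    have := congrArg Prod.fst hab
    simpa [hΛ] using this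
  have hΛfin : Λ.toRingHom.Finite := by
    letI : Algebra P (P × ℤ_[3]) := Λ.toRingHom.toAlgebra
    change Module.Finite P (P × ℤ_[3])
    refine ⟨⟨{((1 : P), (0 : ℤ_[3])), ((0 : P), (1 : ℤ_[3]))}, ?_⟩⟩
    rw [Submodule.eq_top_iff']
    rintro ⟨a, c⟩
    rw [Finset.coe_insert, Finset.coe_singleton, Submodule.mem_span_insert]
    refine ⟨a, (MvPowerSeries.C c : P) • ((0 : P), (1 : ℤ_[3])),
      Submodule.smul_mem _ _ (Submodule.mem_span_singleton_self _), ?_⟩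
    change (a, c) = Λ a * ((1 : P), (0 : ℤ_[3])) + Λ (MvPowerSeries.C c) * ((0 : P), (1 : ℤ_[3]))
    rw [hΛ, hΛ]
    ext <;> simp
  -- the point x of the torsion factor
  let x : P × ℤ_[3] →+* PadicAlgCl 3 := ι.comp (RingHom.snd P ℤ_[3])
  have hx : x.comp (algebraMap ℤ_[3] (P × ℤ_[3])) = ι := by
    ext r; simp [x]
  have hxΛ : ∀ a, x (Λ a) = ι (MvPowerSeries.constantCoeff a) := fun a => rfl
  -- the weights κ_M = ι ∘ (evaluation at the small point b_M)
  let b : ℕ → Fin 3 → ℤ_[3] := fun M i => if i = 0 then (3 : ℤ_[3]) ^ (M + 1) else 0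
  have hb : ∀ M i, ‖b M i‖ ≤ ((3 : ℝ)⁻¹) ^ (M + 1) := fun M i => norm_smallPoint_le M i
  let κ : ℕ → (P →+* PadicAlgCl 3) := fun M =>
    ι.comp (MvPowerSeries.aeval (padicInt_mvHasEval
      (fun i => (hb M i).trans_lt (inv_three_pow_succ_lt_one M)))).toRingHom
  have hκX : ∀ M, κ M (MvPowerSeries.X 0) = ι ((3 : ℤ_[3]) ^ (M + 1)) := by
    intro M
    simp only [κ, RingHom.coe_comp, Function.comp_apply, AlgHom.toRingHom_eq_coe, RingHom.coe_coe]
    congr 1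
    rw [MvPowerSeries.coe_aeval, MvPowerSeries.eval₂_X]
    simp [b]
  let W : Set (P →+* PadicAlgCl 3) := Set.range κ
  have hW : ∀ M : ℕ, ∃ κ' ∈ W, ∀ a, ‖κ' a - x (Λ a)‖ ≤ ((3 : ℝ)⁻¹) ^ M := by
    intro M
    refine ⟨κ M, ⟨M, rfl⟩, fun a => ?_⟩
    rw [hxΛ]
    simp only [κ, RingHom.coe_comp, Function.comp_apply, AlgHom.toRingHom_eq_coe, RingHom.coe_coe]
    rw [← map_sub, norm_algebraMap_padicAlgCl]
    calc _ ≤ ((3 : ℝ)⁻¹) ^ (M + 1) :=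
          norm_aeval_sub_constantCoeff_le (by positivity) (inv_three_pow_succ_lt_one M) (hb M) a
      _ ≤ ((3 : ℝ)⁻¹) ^ M := pow_le_pow_of_le_one (by norm_num) (by norm_num) (Nat.le_succ M)
  -- apply the would-be statement at M = 1
  have hj : ι.comp (algebraMap ℤ_[3] ℤ_[3]) = algebraMap ℤ_[3] (PadicAlgCl 3) := by
    ext r; simp [hι]
  obtain ⟨κ', ⟨M, rfl⟩, y, hyΛ, hy⟩ := h ℤ_[3] ι hιinj hj (P × ℤ_[3]) Λ hΛinj hΛfin x hx W hW 1
  -- the idempotent of the torsion factor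
  set e : P × ℤ_[3] := (0, 1) with he
  have hxe : x e = 1 := by simp [x, e]
  have hye : y e = 0 ∨ y e = 1 := by
    have h2 : y e * y e = y e := by rw [← map_mul]; simp [e]
    rcases mul_eq_zero.mp (show y e * (y e - 1) = 0 by rw [mul_sub, mul_one, h2, sub_self])
      with h0 | h1
    · exact Or.inl h0
    · exact Or.inr (sub_eq_zero.mp h1)
  rcases hye with h0 | h1
  · have := hy e
    rw [h0, hxe, zero_sub, norm_neg, norm_one, pow_one] at this
    norm_num at this
  · -- y kills (1,0), hence y (Λ X₀) = y (X₀, 0) = 0; but κ_M X₀ = 3^(M+1) ≠ 0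
    have h10 : y ((1 : P), (0 : ℤ_[3])) = 0 := by
      have : ((1 : P), (0 : ℤ_[3])) = 1 - e := by rw [he]; ext <;> simp
      rw [this, map_sub, map_one, h1, sub_self]
    have hX : y (Λ (MvPowerSeries.X 0)) = 0 := by
      have : Λ (MvPowerSeries.X 0) = ((MvPowerSeries.X 0 : P), (0 : ℤ_[3])) := by
        rw [hΛ]; simp
      rw [this]
      have : ((MvPowerSeries.X 0 : P), (0 : ℤ_[3])) =
          ((MvPowerSeries.X 0 : P), (0 : ℤ_[3])) * ((1 : P), (0 : ℤ_[3])) := by simp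
      rw [this, map_mul, h10, mul_zero]
    have hκ0 : κ M (MvPowerSeries.X 0) = 0 := by
      have := congrArg (fun φ : P →+* PadicAlgCl 3 => φ (MvPowerSeries.X 0)) hyΛ
      simp only [RingHom.coe_comp, Function.comp_apply, AlgHom.toRingHom_eq_coe,
        RingHom.coe_coe] at this
      rw [← this]; exact hX
    rw [hκX] at hκ0
    have h3 : ((3 : ℤ_[3]) ^ (M + 1)) = 0 := hιinj (by rw [hκ0, map_zero])
    exact absurd h3 (pow_ne_zero _ (by norm_num))

end

end Summit.Langlands.Langlands.Theorems.MuOrdinaryFamilyRT.Negative
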